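import Literature.MathematicalPhysics.QuantumLattice.StrongExpDecayBoundaryInfluenceNonlocal
import HarnessLib

/-!
# Boundary influence under exponential decay of correlations, III: the `r`-neighbourhood cube
# (Chatterjee, CMP 385 (2021), Lemma 7.2) and Corollary 7.4 / Lemma 7.5 on cubes, instantiated

S. Chatterjee, *A probabilistic mechanism for quark confinement*, CMP **385** (2021) [Chatterjee2021], §7. For a
boundary edge `e` (base point `x`) of the cube `B = v + {0,…,M}^d` and `1 ≤ r ≤ M/4`, the **`r`-neighbourhood cube**
`B(e,r) = a + {0,…,4r}^d`, `a_i = max(v_i, min(x_i − 2r, v_i + M − 4r))` (the printed three-case definition of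
`a_i` before Lemma 7.2, written as a clamp), satisfies **Lemma 7.2**: it is a cube of side `4r` inside `B`; `e` is a
boundary edge of it; every edge of `B` adjacent to `e` (here: with base point at sup-distance `≤ 1`) is an edge of it;
and every boundary edge of `B(e,r)` interior to `B` is at (base-point sup-)distance `≥ 2r` from `e`
(`inner_sub_outer`, `edge_mem_inner`, `not_mem_interior_inner`, `mem_inner_of_norm_sub_le_one`,
`two_mul_le_norm_sub_of_boundary_inner`). Together with the general fact that every plaquette through an
interior edge of a cube lies in the cube (`mem_cube_of_mem_closure_interior`), this discharges the geometric
hypotheses of the two-volume form of Lemma 7.3 / Cor. 7.4 / Lemma 7.5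
(`StrongExpDecayBoundaryInfluenceNonlocal.lean`) and yields the printed cube statements, instantiated:

* `abs_integral_update_sub_le_of_strongExpDecayZd_cube` — **Corollary 7.4** (first claim, integrated): under
  Def. 2.3 with constants `K₁, K₂ ≥ 0` and `|Re tr ρ(U_p)| ≤ C`, changing the boundary condition of the cube `B`
  at one boundary edge `e` changes `∫ f dγ_Λ(·|η)` by at most
  `e^{2c̄} · 2 d (4r+1)^d · e^{2c̄} K₁ e^{−2 K₂ r}`, `c̄ = 4(d−1) C |β|`, for every measurable `f` with `|f| ≤ 1`
  reading only links at base-point sup-distance `> 4r` from `e` (printed: `C₁ r^{d−1} e^{−C₂ r}` for `f` not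
  reading `E(e,r)`);
* `abs_integral_sub_le_of_strongExpDecayZd_cube_of_eqOn` — **Lemma 7.5**: `|A|` times that for boundary
  conditions differing on a finite set `A` of boundary edges, `f` reading only links at distance `> 4r` from `A`
  (the expectation form of **Corollary 7.6**).

Derivative-free and valid for every compact metrisable gauge group, like parts I–II. Not here: §§8–11.

## References
* S. Chatterjee, CMP 385 (2021), arXiv:2006.16229: §7, definition of `B(e,r)`, Lemma 7.2, Cor. 7.4, Lemma 7.5,
  Cor. 7.6.
-/

noncomputable section

open MeasureTheory Filter Function
open scoped Topology

namespace Literature.MathematicalPhysics.QuantumLattice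

open Literature.Probability.LatticeModels
open Literature.MathematicalPhysics.QuantumFieldTheory (apply_sub_eq_zero_or_one_of_mem_plaquetteEdges
  norm_sub_le_one_of_mem_plaquetteEdges)

/-! ### §1 Coordinates of plaquette edges; plaquettes through interior edges of a cube -/

section Geometry

variable {d : ℕ}

/-- The base point of an edge of the plaquette `p` agrees with the base point of `p` in the edge's own
direction (the four edges are `(y,i), (y+eᵢ,j), (y+eⱼ,i), (y,j)`). [folklore] -/
private theorem apply_dir_eq_of_mem_plaquetteEdges {p : ZdPlaquette d} {u : ZdEdge d}
    (hu : u ∈ plaquetteEdges p) : u.1 u.2 = p.1 u.2 := by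
  have hne : p.2.1.1 ≠ p.2.1.2 := (p.2.2).ne
  simp only [plaquetteEdges, Finset.mem_insert, Finset.mem_singleton] at hu
  rcases hu with rfl | rfl | rfl | rfl
  · rfl
  · simp [hne]
  · simp [Ne.symm hne]
  · rfl

/-- **Every plaquette through an interior edge of a cube lies in the cube** (Chatterjee 2021 §7: the kernel of
the interior edges of `B_N` is the lattice gauge theory on `B_N` with a boundary condition): if `w` is an
interior edge of the cube `v + {0,…,K}^d` and `u` lies on a common plaquette with `w`, then `u` is an edge of the
cube. [cite: Chatterjee2021, §7 (lattice gauge theory in a cube)] -/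
theorem mem_cube_of_mem_plaquetteEdges_of_interior {v : Fin d → ℤ} {K : ℕ} {p : ZdPlaquette d}
    {w u : ZdEdge d} (hw : w ∈ plaquetteEdges p) (hu : u ∈ plaquetteEdges p)
    (hwc : ∀ j, v j ≤ w.1 j ∧ w.1 j ≤ v j + K) (hwk : w.1 w.2 + 1 ≤ v w.2 + K)
    (hwint : ∀ j, j ≠ w.2 → v j < w.1 j ∧ w.1 j < v j + K) :
    (∀ j, v j ≤ u.1 j ∧ u.1 j ≤ v j + K) ∧ u.1 u.2 + 1 ≤ v u.2 + K := by
  have hu0 := apply_sub_eq_zero_or_one_of_mem_plaquetteEdges hu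
  have hw0 := apply_sub_eq_zero_or_one_of_mem_plaquetteEdges hw
  have hwd := apply_dir_eq_of_mem_plaquetteEdges hw
  have hud := apply_dir_eq_of_mem_plaquetteEdges hu
  -- the base point of `p` is well inside in every coordinate
  have hp : ∀ j, v j ≤ p.1 j ∧ p.1 j + 1 ≤ v j + K := by
    intro j
    by_cases hj : j = w.2
    · subst hj
      have h1 := (hwc w.2).1
      rw [hwd] at h1 hwk
      exact ⟨h1, hwk⟩
    · have h1 := hwint j hj
      rcases hw0 j with h | h <;> constructor <;> omega
  refine ⟨fun j => ?_, ?_⟩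
  · rcases hu0 j with h | h <;> constructor <;> linarith [(hp j).1, (hp j).2]
  · rw [hud]; exact (hp u.2).2

/-- Closure form: a link of a plaquette touching the interior link set `Λ'` of the cube `v' + {0,…,K}^d` is an
edge of that cube. [cite: Chatterjee2021, §7 (lattice gauge theory in a cube)] -/
theorem mem_cube_of_mem_closure_interior {v' : Fin d → ℤ} {K : ℕ} {Λ' : Finset (ZdEdge d)}
    (hΛ' : Λ' = (((Fintype.piFinset fun j : Fin d => Finset.Icc (v' j) (v' j + K)) ×ˢ
        (Finset.univ : Finset (Fin d))).filter fun e =>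
          e.1 e.2 + 1 ≤ v' e.2 + K ∧ ∀ j, j ≠ e.2 → v' j < e.1 j ∧ e.1 j < v' j + K))
    {u : ZdEdge d} (hu : u ∈ (plaquettesTouching Λ').biUnion plaquetteEdges) :
    (∀ j, v' j ≤ u.1 j ∧ u.1 j ≤ v' j + K) ∧ u.1 u.2 + 1 ≤ v' u.2 + K := by
  classical
  obtain ⟨p, hp, hup⟩ := Finset.mem_biUnion.1 hu
  obtain ⟨w, hw⟩ := mem_plaquettesTouching_iff.1 hp
  obtain ⟨hwp, hwΛ⟩ := Finset.mem_inter.1 hw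
  rw [hΛ'] at hwΛ
  simp only [Finset.mem_filter, Finset.mem_product, Fintype.mem_piFinset, Finset.mem_Icc,
    Finset.mem_univ, and_true] at hwΛ
  exact mem_cube_of_mem_plaquetteEdges_of_interior hwp hup hwΛ.1 hwΛ.2.1 hwΛ.2.2

/-- Unfolding membership in the interior link set of a cube. [folklore] -/
private theorem mem_interior_iff {v : Fin d → ℤ} {K : ℕ} {Λ : Finset (ZdEdge d)}
    (hΛ : Λ = (((Fintype.piFinset fun j : Fin d => Finset.Icc (v j) (v j + K)) ×ˢ
        (Finset.univ : Finset (Fin d))).filter fun e =>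
          e.1 e.2 + 1 ≤ v e.2 + K ∧ ∀ j, j ≠ e.2 → v j < e.1 j ∧ e.1 j < v j + K))
    (u : ZdEdge d) :
    u ∈ Λ ↔ (∀ j, v j ≤ u.1 j ∧ u.1 j ≤ v j + K) ∧ u.1 u.2 + 1 ≤ v u.2 + K ∧
      ∀ j, j ≠ u.2 → v j < u.1 j ∧ u.1 j < v j + K := by
  classical
  rw [hΛ]
  simp only [Finset.mem_filter, Finset.mem_product, Fintype.mem_piFinset, Finset.mem_Icc,
    Finset.mem_univ, and_true]

/-! ### §2 The `r`-neighbourhood cube `B(e,r)` (Chatterjee 2021, Lemma 7.2) -/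

/-- **Lemma 7.2 (i)**: the `r`-neighbourhood cube `a + {0,…,4r}^d`, `a_i = max(v_i, min(x_i − 2r, v_i + M − 4r))`,
of an edge `e = (x, k)` of the cube `v + {0,…,M}^d` with `4r ≤ M` lies inside that cube. [cite: Chatterjee2021, Lemma 7.2] -/
theorem inner_sub_outer {v a x : Fin d → ℤ} {M r : ℕ} (hrM : 4 * r ≤ M)
    (ha : ∀ i, a i = max (v i) (min (x i - 2 * r) (v i + M - 4 * r))) (i : Fin d) :
    v i ≤ a i ∧ a i + 4 * r ≤ v i + M := by
  have h := ha i
  have hrM' : (4 * r : ℤ) ≤ M := by exact_mod_cast hrM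
  constructor
  · rw [h]; exact le_max_left _ _
  · rw [h]
    rcases le_total (v i) (min (x i - 2 * r) (v i + M - 4 * r)) with hle | hle
    · rw [max_eq_right hle]; linarith [min_le_right (x i - 2 * r) (v i + M - 4 * r)]
    · rw [max_eq_left hle]; linarith

/-- **Lemma 7.2 (ii)**: `e` is an edge of its `r`-neighbourhood cube. [cite: Chatterjee2021, Lemma 7.2] -/
theorem edge_mem_inner {v a : Fin d → ℤ} {M r : ℕ} (hr : 1 ≤ r) (hrM : 4 * r ≤ M) {e : ZdEdge d}
    (he : ∀ j, v j ≤ e.1 j ∧ e.1 j ≤ v j + M) (he' : e.1 e.2 + 1 ≤ v e.2 + M)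
    (ha : ∀ i, a i = max (v i) (min (e.1 i - 2 * r) (v i + M - 4 * r))) :
    (∀ j, a j ≤ e.1 j ∧ e.1 j ≤ a j + 4 * r) ∧ e.1 e.2 + 1 ≤ a e.2 + 4 * r := by
  have hr' : (1 : ℤ) ≤ r := by exact_mod_cast hr
  have hrM' : (4 * r : ℤ) ≤ M := by exact_mod_cast hrM
  have key : ∀ j, a j ≤ e.1 j ∧ e.1 j ≤ a j + 4 * r ∧ (e.1 j + 1 ≤ v j + M → e.1 j + 1 ≤ a j + 4 * r) := by
    intro j
    have h := ha j
    have h1 := (he j).1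
    have h2 := (he j).2
    rcases le_total (v j) (min (e.1 j - 2 * r) (v j + M - 4 * r)) with hle | hle
    · rw [max_eq_right hle] at h
      rcases le_total (e.1 j - 2 * r) (v j + M - 4 * r) with hle' | hle'
      · rw [min_eq_left hle'] at h; refine ⟨by linarith, by linarith, fun _ => by linarith⟩
      · rw [min_eq_right hle'] at h; refine ⟨by linarith, by linarith, fun h3 => by linarith⟩
    · rw [max_eq_left hle] at h
      have hmin := hle
      refine ⟨by linarith, ?_, fun h3 => ?_⟩
      · rcases le_total (e.1 j - 2 * r) (v j + M - 4 * r) with hle' | hle'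
        · rw [min_eq_left hle'] at hmin; linarith
        · rw [min_eq_right hle'] at hmin; linarith
      · rcases le_total (e.1 j - 2 * r) (v j + M - 4 * r) with hle' | hle'
        · rw [min_eq_left hle'] at hmin; linarith
        · rw [min_eq_right hle'] at hmin; linarith
  exact ⟨fun j => ⟨(key j).1, (key j).2.1⟩, (key e.2).2.2 he'⟩

/-- **Lemma 7.2 (ii')**: a BOUNDARY edge `e` of the outer cube (an edge of it that is not interior) is not an
interior edge of its `r`-neighbourhood cube. [cite: Chatterjee2021, Lemma 7.2] -/
theorem not_mem_interior_inner {v a : Fin d → ℤ} {M r : ℕ} {Λ Λ' : Finset (ZdEdge d)}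
    (hΛ : Λ = (((Fintype.piFinset fun j : Fin d => Finset.Icc (v j) (v j + M)) ×ˢ
        (Finset.univ : Finset (Fin d))).filter fun e =>
          e.1 e.2 + 1 ≤ v e.2 + M ∧ ∀ j, j ≠ e.2 → v j < e.1 j ∧ e.1 j < v j + M))
    (hΛ' : Λ' = (((Fintype.piFinset fun j : Fin d => Finset.Icc (a j) (a j + 4 * r)) ×ˢ
        (Finset.univ : Finset (Fin d))).filter fun e =>
          e.1 e.2 + 1 ≤ a e.2 + 4 * r ∧ ∀ j, j ≠ e.2 → a j < e.1 j ∧ e.1 j < a j + 4 * r))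
(hrM : 4 * r ≤ M) {e : ZdEdge d} (he : ∀ j, v j ≤ e.1 j ∧ e.1 j ≤ v j + M) (he' : e.1 e.2 + 1 ≤ v e.2 + M)
    (heΛ : e ∉ Λ) (ha : ∀ i, a i = max (v i) (min (e.1 i - 2 * r) (v i + M - 4 * r))) :
    e ∉ Λ' := by
  have hK : (4 * r : ℕ) = (4 * r : ℤ) := by push_cast; ring
  intro heΛ'
  rw [mem_interior_iff hΛ'] at heΛ'
  rw [mem_interior_iff hΛ] at heΛ
  apply heΛ
  refine ⟨he, he', fun j hj => ?_⟩
  have h3 := heΛ'.2.2 j hj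
  have h := ha j
  have h1 := (he j).1
  have h2 := (he j).2
  push_cast at h3
  -- if `e.1 j = v j` or `= v j + M` the clamp puts `e` on a face of the inner cube
  constructor
  · by_contra hlt
    have heq : e.1 j = v j := le_antisymm (not_lt.1 hlt) h1
    have : a j = v j := by
      rw [h, heq, max_eq_left]
      exact (min_le_left _ _).trans (by linarith)
    linarith [h3.1]
  · by_contra hlt
    have heq : e.1 j = v j + M := le_antisymm h2 (not_lt.1 hlt)
    have : a j = v j + M - 4 * r := by
      rw [h, heq]
      have hmin : min (v j + ↑M - 2 * ↑r) (v j + ↑M - 4 * ↑r) = v j + M - 4 * r := min_eq_right (by linarith)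
      rw [hmin, max_eq_right]
      have : (4 * r : ℤ) ≤ M := by exact_mod_cast hrM
      linarith
    linarith [h3.2]

/-- **Lemma 7.2 (iii)**: every edge of the outer cube whose base point is at sup-distance `≤ 1` from that of `e`
(in particular every edge adjacent to `e`) is an edge of the `r`-neighbourhood cube (`r ≥ 1`).
[cite: Chatterjee2021, Lemma 7.2] -/
theorem mem_inner_of_norm_sub_le_one {v a : Fin d → ℤ} {M r : ℕ} (hr : 1 ≤ r)
    {e u : ZdEdge d} (hu : ∀ j, v j ≤ u.1 j ∧ u.1 j ≤ v j + M) (hu' : u.1 u.2 + 1 ≤ v u.2 + M)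
    (hdist : ‖e.1 - u.1‖ ≤ (1 : ℝ))
    (ha : ∀ i, a i = max (v i) (min (e.1 i - 2 * r) (v i + M - 4 * r))) :
    (∀ j, a j ≤ u.1 j ∧ u.1 j ≤ a j + 4 * r) ∧ u.1 u.2 + 1 ≤ a u.2 + 4 * r := by
  have hr' : (1 : ℤ) ≤ r := by exact_mod_cast hr
  have hcoord : ∀ j, e.1 j - 1 ≤ u.1 j ∧ u.1 j ≤ e.1 j + 1 := by
    intro j
    have h1 : ‖(e.1 - u.1) j‖ ≤ 1 := (norm_le_pi_norm _ j).trans hdist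
    rw [Pi.sub_apply, Int.norm_eq_abs, Int.cast_sub, abs_le] at h1
    obtain ⟨h1a, h1b⟩ := h1
    constructor
    · have : ((e.1 j : ℤ) : ℝ) - 1 ≤ ((u.1 j : ℤ) : ℝ) := by linarith
      exact_mod_cast this
    · have : ((u.1 j : ℤ) : ℝ) ≤ ((e.1 j : ℤ) : ℝ) + 1 := by linarith
      exact_mod_cast this
  have key : ∀ j, a j ≤ u.1 j ∧ u.1 j ≤ a j + 4 * r ∧ (u.1 j + 1 ≤ v j + M → u.1 j + 1 ≤ a j + 4 * r) := by
    intro j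
    have h := ha j
    obtain ⟨hc1, hc2⟩ := hcoord j
    have h1 := (hu j).1
    have h2 := (hu j).2
    rcases le_total (v j) (min (e.1 j - 2 * r) (v j + M - 4 * r)) with hle | hle
    · rw [max_eq_right hle] at h
      rcases le_total (e.1 j - 2 * r) (v j + M - 4 * r) with hle' | hle'
      · rw [min_eq_left hle'] at h; refine ⟨by linarith, by linarith, fun _ => by linarith⟩
      · rw [min_eq_right hle'] at h; refine ⟨by linarith, by linarith, fun h3 => by linarith⟩
    · rw [max_eq_left hle] at h
      have hmin := hle
      refine ⟨by linarith, ?_, fun h3 => ?_⟩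
      · rcases le_total (e.1 j - 2 * r) (v j + M - 4 * r) with hle' | hle'
        · rw [min_eq_left hle'] at hmin; linarith
        · rw [min_eq_right hle'] at hmin; linarith
      · rcases le_total (e.1 j - 2 * r) (v j + M - 4 * r) with hle' | hle'
        · rw [min_eq_left hle'] at hmin; linarith
        · rw [min_eq_right hle'] at hmin; linarith
  exact ⟨fun j => ⟨(key j).1, (key j).2.1⟩, (key u.2).2.2 hu'⟩

/-- **Lemma 7.2 (iv)**: a boundary edge `u` of the `r`-neighbourhood cube (an edge of it that is not interior to
it) which is INTERIOR to the outer cube has base point at sup-distance `≥ 2r` from that of `e` («any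
`u ∈ ∂E(e,r) ∖ ∂E_N` must satisfy `dist(e,u) > r`», with base points in place of midpoints).
[cite: Chatterjee2021, Lemma 7.2] -/
theorem two_mul_le_norm_sub_of_boundary_inner {v a : Fin d → ℤ} {M r : ℕ} {Λ Λ' : Finset (ZdEdge d)}
    (hΛ : Λ = (((Fintype.piFinset fun j : Fin d => Finset.Icc (v j) (v j + M)) ×ˢ
        (Finset.univ : Finset (Fin d))).filter fun e =>
          e.1 e.2 + 1 ≤ v e.2 + M ∧ ∀ j, j ≠ e.2 → v j < e.1 j ∧ e.1 j < v j + M))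
    (hΛ' : Λ' = (((Fintype.piFinset fun j : Fin d => Finset.Icc (a j) (a j + 4 * r)) ×ˢ
        (Finset.univ : Finset (Fin d))).filter fun e =>
          e.1 e.2 + 1 ≤ a e.2 + 4 * r ∧ ∀ j, j ≠ e.2 → a j < e.1 j ∧ e.1 j < a j + 4 * r))
    {e : ZdEdge d} (he : ∀ j, v j ≤ e.1 j ∧ e.1 j ≤ v j + M)
    (ha : ∀ i, a i = max (v i) (min (e.1 i - 2 * r) (v i + M - 4 * r)))
    {u : ZdEdge d} (hu : ∀ j, a j ≤ u.1 j ∧ u.1 j ≤ a j + 4 * r) (hu' : u.1 u.2 + 1 ≤ a u.2 + 4 * r)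
    (huΛ' : u ∉ Λ') (huΛ : u ∈ Λ) : (2 * r : ℝ) ≤ ‖u.1 - e.1‖ := by
  have hK : (4 * r : ℕ) = (4 * r : ℤ) := by push_cast; ring
  rw [mem_interior_iff hΛ] at huΛ
  rw [mem_interior_iff hΛ'] at huΛ'
  -- `u` lies in a face `x_j = a_j` or `x_j = a_j + 4r` (`j ≠ u.2`) of the inner cube
  have hface : ∃ j, j ≠ u.2 ∧ (u.1 j = a j ∨ u.1 j = a j + 4 * r) := by
    by_contra hcon
    push Not at hcon
    apply huΛ'
    refine ⟨fun j => ?_, by exact_mod_cast hu', fun j hj => ?_⟩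
    · have := hu j; exact_mod_cast this
    · obtain ⟨h1, h2⟩ := hcon j hj
      have h3 := (hu j).1
      have h4 := (hu j).2
      push_cast
      exact ⟨lt_of_le_of_ne h3 (Ne.symm h1), lt_of_le_of_ne h4 h2⟩
  obtain ⟨j, hj, hj'⟩ := hface
  -- this face coordinate is strictly inside the outer cube, so the clamp is `2r` away from `e`
  have hint := huΛ.2.2 j hj
  have h := ha j
  have he1 := (he j).1
  have he2 := (he j).2
  have hcoord : 2 * (r : ℤ) ≤ |u.1 j - e.1 j| := by
    rw [le_abs]
    rcases hj' with hj' | hj'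
    · -- `u.1 j = a j > v j`: clamp below inactive
      rcases le_total (v j) (min (e.1 j - 2 * r) (v j + M - 4 * r)) with hle | hle
      · rw [max_eq_right hle] at h
        rcases le_total (e.1 j - 2 * r) (v j + M - 4 * r) with hle' | hle'
        · rw [min_eq_left hle'] at h; right; linarith
        · rw [min_eq_right hle'] at h; right; linarith
      · rw [max_eq_left hle] at h; linarith [hint.1]
    · -- `u.1 j = a j + 4r < v j + M`: clamp above inactive
      rcases le_total (v j) (min (e.1 j - 2 * r) (v j + M - 4 * r)) with hle | hle
      · rw [max_eq_right hle] at h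
        rcases le_total (e.1 j - 2 * r) (v j + M - 4 * r) with hle' | hle'
        · rw [min_eq_left hle'] at h; left; linarith
        · rw [min_eq_right hle'] at h; linarith [hint.2]
      · rw [max_eq_left hle] at h
        rcases le_total (e.1 j - 2 * r) (v j + M - 4 * r) with hle' | hle'
        · rw [min_eq_left hle'] at hle; left; linarith
        · rw [min_eq_right hle'] at hle; linarith [hint.2]
  calc (2 * r : ℝ) = ((2 * (r : ℤ) : ℤ) : ℝ) := by push_cast; ring
    _ ≤ ((|u.1 j - e.1 j| : ℤ) : ℝ) := by exact_mod_cast hcoord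
    _ = ‖(u.1 - e.1) j‖ := by rw [Pi.sub_apply, Int.norm_eq_abs, Int.cast_abs, Int.cast_sub]
    _ ≤ ‖u.1 - e.1‖ := norm_le_pi_norm _ j

end Geometry

/-! ### §3 Corollary 7.4 and Lemma 7.5 on cubes, instantiated -/

section Cube

variable {d N : ℕ} {G : Type*} [Group G] [TopologicalSpace G] [IsTopologicalGroup G]
  [CompactSpace G] [MeasurableSpace G] [BorelSpace G] [SecondCountableTopology G] [T2Space G]
  (ρ : G →* Matrix (Fin N) (Fin N) ℂ)

omit [TopologicalSpace G] [IsTopologicalGroup G] [CompactSpace G] [MeasurableSpace G] [BorelSpace G]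
  [SecondCountableTopology G] [T2Space G] in
/-- The set distance of two singletons is the sup-distance of the base points. [folklore] -/
private theorem setDistEdges_singleton (e u : ZdEdge d) :
    QuantumFieldTheory.setDistEdges {e} {u} = ‖e.1 - u.1‖ := by
  unfold QuantumFieldTheory.setDistEdges
  rw [dif_pos (by simp)]
  simp

/-- A link sharing a plaquette with `e` has base point at sup-distance `≤ 1`. [folklore] -/
private theorem norm_sub_le_one_of_mem_nbhd {e u : ZdEdge d}
    (hu : u ∈ (plaquettesTouching ({e} : Finset (ZdEdge d))).biUnion plaquetteEdges) :
    ‖e.1 - u.1‖ ≤ (1 : ℝ) := by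
  classical
  obtain ⟨p, hp, hup⟩ := Finset.mem_biUnion.1 hu
  obtain ⟨w, hw⟩ := mem_plaquettesTouching_iff.1 hp
  obtain ⟨hwp, hwe⟩ := Finset.mem_inter.1 hw
  rw [Finset.mem_singleton] at hwe
  subst hwe
  exact norm_sub_le_one_of_mem_plaquetteEdges hwp hup

/-- ★ **Chatterjee 2021, Corollary 7.4 on a cube, instantiated** (first claim, integrated form; derivative-free,
every compact gauge group): exponential decay of correlations with constants `K₁, K₂` (`K₂ ≥ 0`) and
`|Re tr ρ(U_p)| ≤ C`; the cube `v + {0,…,M}^d` with interior link set `Λ`, a boundary condition `η`, a boundary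
edge `e` of the cube (an edge of it outside `Λ`), `1 ≤ r`, `4r ≤ M`. Then for every measurable `f` with
`|f| ≤ 1` reading only links at base-point sup-distance `> 4r` from `e` (in particular none of the
`r`-neighbourhood cube `B(e,r)`), replacing `η_e` by any value changes `∫ f dγ_Λ(·|η)` by at most
`e^{2c̄} · 2 · d(4r+1)^d · e^{2c̄} K₁ e^{−2K₂ r}`, `c̄ = |β| · 2C · 2(d−1)` (printed: `C₁ r^{d−1} e^{−C₂ r}`).
Proof: the two-volume Cor. 7.4 with inner cube `B(e,r)` (Lemma 7.2) and far set `D =` boundary links of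
`B(e,r)` interior to the outer cube, each at distance `≥ 2r` from `e`. [cite: Chatterjee2021, Cor. 7.4] -/
theorem abs_integral_update_sub_le_of_strongExpDecayZd_cube [NeZero d] (hρ : Continuous ρ) {C : ℝ}
    (hC0 : 0 ≤ C) (hC : ∀ (x : Site d) (i j : Fin d) (U : LGConfig d G), |plaquetteObs ρ x i j U| ≤ C)
    {β K₁ K₂ : ℝ} (hdecay : StrongExpDecayZd d ρ β K₁ K₂) (hK₂ : 0 ≤ K₂) (M : ℕ) (v : Fin d → ℤ)
    (Λ : Finset (ZdEdge d))
    (hΛ : Λ = (((Fintype.piFinset fun j : Fin d => Finset.Icc (v j) (v j + M)) ×ˢ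
        (Finset.univ : Finset (Fin d))).filter fun e =>
          e.1 e.2 + 1 ≤ v e.2 + M ∧ ∀ j, j ≠ e.2 → v j < e.1 j ∧ e.1 j < v j + M))
    (η : LGConfig d G) (e : ZdEdge d) (he : ∀ j, v j ≤ e.1 j ∧ e.1 j ≤ v j + M)
    (he' : e.1 e.2 + 1 ≤ v e.2 + M) (heΛ : e ∉ Λ) (r : ℕ) (hr : 1 ≤ r) (hrM : 4 * r ≤ M) (b : G)
    {f : LGConfig d G → ℝ} (hfm : Measurable f) (hf1 : ∀ U, |f U| ≤ 1)
    (hfdep : DependsOn f {u : ZdEdge d | (4 * r : ℝ) < ‖u.1 - e.1‖}) :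
    |(∫ U, f U ∂(ymSpecification ρ β Λ (Function.update η e b))) - ∫ U, f U ∂(ymSpecification ρ β Λ η)| ≤
      Real.exp (2 * (|β| * (2 * C * (2 * (d - 1 : ℕ) : ℕ)))) *
        (2 * ((d * (4 * r + 1) ^ d : ℕ) *
          (Real.exp (2 * (|β| * (2 * C * (2 * (d - 1 : ℕ) : ℕ)))) * (K₁ * Real.exp (-(K₂ * (2 * r))))))) := by
  classical
  have hK₁ : 0 ≤ K₁ := hdecay.nonneg
  have hcast : ((4 * r : ℕ) : ℤ) = 4 * (r : ℤ) := by push_cast; ring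
  -- the `r`-neighbourhood cube `B(e,r) = a + {0,…,4r}^d`
  set a : Fin d → ℤ := fun i => max (v i) (min (e.1 i - 2 * r) (v i + M - 4 * r)) with ha_def
  have ha : ∀ i, a i = max (v i) (min (e.1 i - 2 * r) (v i + M - 4 * r)) := fun i => rfl
  set Λ' : Finset (ZdEdge d) := (((Fintype.piFinset fun j : Fin d => Finset.Icc (a j) (a j + (4 * r : ℕ))) ×ˢ
      (Finset.univ : Finset (Fin d))).filter fun e =>
        e.1 e.2 + 1 ≤ a e.2 + (4 * r : ℕ) ∧ ∀ j, j ≠ e.2 → a j < e.1 j ∧ e.1 j < a j + (4 * r : ℕ)) with hΛ'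
  have hΛ'' : Λ' = (((Fintype.piFinset fun j : Fin d => Finset.Icc (a j) (a j + 4 * r)) ×ˢ
      (Finset.univ : Finset (Fin d))).filter fun e =>
        e.1 e.2 + 1 ≤ a e.2 + 4 * r ∧ ∀ j, j ≠ e.2 → a j < e.1 j ∧ e.1 j < a j + 4 * r) := by
    rw [hΛ', hcast]
  have hio := inner_sub_outer (x := e.1) hrM ha
  -- `Λ' ⊆ Λ`
  have hsub : Λ' ⊆ Λ := by
    intro u hu
    rw [mem_interior_iff hΛ''] at hu
    rw [mem_interior_iff hΛ]
    obtain ⟨h1, h2, h3⟩ := hu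
    refine ⟨fun j => ⟨(hio j).1.trans (h1 j).1, (h1 j).2.trans (hio j).2⟩, h2.trans (hio u.2).2,
      fun j hj => ⟨(hio j).1.trans_lt (h3 j hj).1, (h3 j hj).2.trans_le (hio j).2⟩⟩
  -- `e` is a boundary edge of the inner cube
  have hein := edge_mem_inner hr hrM he he' ha
  have heΛ' : e ∉ Λ' := not_mem_interior_inner hΛ hΛ'' hrM he he' heΛ ha
  -- the far boundary links of the inner cube
  set D : Finset (ZdEdge d) := (((Fintype.piFinset fun j : Fin d => Finset.Icc (a j) (a j + (4 * r : ℕ))) ×ˢ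
      (Finset.univ : Finset (Fin d))).filter fun u =>
        u.1 u.2 + 1 ≤ a u.2 + (4 * r : ℕ) ∧ u ∈ Λ ∧ u ∉ Λ') with hD_def
  have hmemD : ∀ u, u ∈ D ↔ ((∀ j, a j ≤ u.1 j ∧ u.1 j ≤ a j + (4 * r : ℕ)) ∧
      u.1 u.2 + 1 ≤ a u.2 + (4 * r : ℕ)) ∧ u ∈ Λ ∧ u ∉ Λ' := fun u => by
    rw [hD_def]
    simp only [Finset.mem_filter, Finset.mem_product, Fintype.mem_piFinset, Finset.mem_Icc,
      Finset.mem_univ, and_true]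
    tauto
  have hfar : ∀ u ∈ D, (2 * r : ℝ) ≤ ‖u.1 - e.1‖ := fun u hu => by
    obtain ⟨⟨hu1, hu2⟩, huΛ, huΛ'⟩ := (hmemD u).1 hu
    rw [hcast] at hu1 hu2
    exact two_mul_le_norm_sub_of_boundary_inner hΛ hΛ'' he ha hu1 hu2 huΛ' huΛ
  have hD : ∀ u ∈ D, (∀ j, a j ≤ u.1 j ∧ u.1 j ≤ a j + (4 * r : ℕ)) ∧ u.1 u.2 + 1 ≤ a u.2 + (4 * r : ℕ) ∧
      u ∉ Λ' ∧ u ∉ (plaquettesTouching ({e} : Finset (ZdEdge d))).biUnion plaquetteEdges := by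
    intro u hu
    obtain ⟨⟨hu1, hu2⟩, huΛ, huΛ'⟩ := (hmemD u).1 hu
    refine ⟨hu1, hu2, huΛ', fun hun => ?_⟩
    have h1 := norm_sub_le_one_of_mem_nbhd hun
    have h2 := hfar u hu
    rw [norm_sub_rev] at h2
    have hr' : (1 : ℝ) ≤ r := by exact_mod_cast hr
    linarith
  have hread : ∀ u, u ∉ Λ' → (u ∈ (plaquettesTouching Λ').biUnion plaquetteEdges ∨
      u ∈ (plaquettesTouching ({e} : Finset (ZdEdge d))).biUnion plaquetteEdges) → u ∈ D ∨ u ∉ Λ := by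
    intro u huΛ' hu
    by_cases huΛ : u ∈ Λ
    · left
      rw [hmemD]
      refine ⟨?_, huΛ, huΛ'⟩
      rcases hu with hu | hu
      · exact mem_cube_of_mem_closure_interior hΛ' hu
      · have huo := ((mem_interior_iff hΛ u).1 huΛ)
        have h := mem_inner_of_norm_sub_le_one hr huo.1 huo.2.1 (norm_sub_le_one_of_mem_nbhd hu) ha
        rw [hcast]
        exact h
    · exact Or.inr huΛ
  -- `f` does not read the inner cube nor `e`
  have hinner_close : ∀ u : ZdEdge d, (∀ j, a j ≤ u.1 j ∧ u.1 j ≤ a j + 4 * r) → ‖u.1 - e.1‖ ≤ (4 * r : ℝ) := by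
    intro u hu
    refine (pi_norm_le_iff_of_nonneg (by positivity)).2 fun j => ?_
    rw [Pi.sub_apply, Int.norm_eq_abs, Int.cast_sub, abs_le]
    have h1 := (hu j).1; have h2 := (hu j).2; have h3 := (hein.1 j).1; have h4 := (hein.1 j).2
    have h1' : ((a j : ℤ) : ℝ) ≤ ((u.1 j : ℤ) : ℝ) := by exact_mod_cast h1
    have h2' : ((u.1 j : ℤ) : ℝ) ≤ ((a j : ℤ) : ℝ) + 4 * r := by exact_mod_cast h2
    have h3' : ((a j : ℤ) : ℝ) ≤ ((e.1 j : ℤ) : ℝ) := by exact_mod_cast h3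
    have h4' : ((e.1 j : ℤ) : ℝ) ≤ ((a j : ℤ) : ℝ) + 4 * r := by exact_mod_cast h4
    constructor <;> linarith
  have hfdep' : DependsOn f ((↑Λ' : Set (ZdEdge d))ᶜ) := by
    intro U V hUV
    refine hfdep fun u hu => hUV u fun huΛ' => ?_
    have hu' := ((mem_interior_iff hΛ'' u).1 (Finset.mem_coe.1 huΛ')).1
    have := hinner_close u hu'
    simp only [Set.mem_setOf_eq] at hu
    linarith
  have hfa : ∀ U, f (Function.update U e b) = f U := fun U =>
    hfdep fun u hu => Function.update_of_ne (by
      rintro rfl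
      simp only [Set.mem_setOf_eq, sub_self, norm_zero] at hu
      have : (0 : ℝ) ≤ 4 * r := by positivity
      linarith) _ _
  -- the two-volume estimate
  have hein' : (∀ j, a j ≤ e.1 j ∧ e.1 j ≤ a j + (4 * r : ℕ)) ∧ e.1 e.2 + 1 ≤ a e.2 + (4 * r : ℕ) := by
    rw [hcast]; exact hein
  have key := abs_integral_update_sub_le_of_strongExpDecayZd_twoVolume ρ hρ hC0 hC hdecay Λ η (4 * r) a Λ' hΛ'
    hsub e hein'.1 hein'.2 heΛ D hD hread b hfm hf1 hfdep' hfa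
  refine key.trans ?_
  -- uniform bounds: `c_u ≤ c̄`, `dist(e,u) ≥ 2r`, `#D ≤ d (4r+1)^d`
  set Ssum : ℝ := ∑ u ∈ D, Real.exp (2 * (|β| * (2 * C * (plaquettesTouching ({u} : Finset (ZdEdge d))).card))) *
      (K₁ * Real.exp (-(K₂ * QuantumFieldTheory.setDistEdges {e} {u}))) with hSsum
  set cbar : ℝ := |β| * (2 * C * (2 * (d - 1 : ℕ) : ℕ)) with hcbar
  have hcu : ∀ u : ZdEdge d, |β| * (2 * C * (plaquettesTouching ({u} : Finset (ZdEdge d))).card) ≤ cbar := by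
    intro u
    have hc : ((plaquettesTouching ({u} : Finset (ZdEdge d))).card : ℝ) ≤ ((2 * (d - 1 : ℕ) : ℕ) : ℝ) := by
      exact_mod_cast QuantumFieldTheory.card_plaquettesTouching_singleton_le u
    exact mul_le_mul_of_nonneg_left (mul_le_mul_of_nonneg_left hc (by positivity)) (abs_nonneg β)
  have hterm : ∀ u ∈ D, Real.exp (2 * (|β| * (2 * C * (plaquettesTouching ({u} : Finset (ZdEdge d))).card))) *
      (K₁ * Real.exp (-(K₂ * QuantumFieldTheory.setDistEdges {e} {u}))) ≤
        Real.exp (2 * cbar) * (K₁ * Real.exp (-(K₂ * (2 * r)))) := by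
    intro u hu
    refine mul_le_mul (Real.exp_le_exp.2 (by linarith [hcu u])) ?_ (by positivity) (by positivity)
    refine mul_le_mul_of_nonneg_left (Real.exp_le_exp.2 ?_) hK₁
    rw [setDistEdges_singleton, norm_sub_rev]
    have := hfar u hu
    nlinarith
  have hsum : Ssum ≤ D.card * (Real.exp (2 * cbar) * (K₁ * Real.exp (-(K₂ * (2 * r))))) := by
    have := Finset.sum_le_card_nsmul _ _ _ hterm
    rwa [nsmul_eq_mul] at this
  have hcard : (D.card : ℝ) ≤ ((d * (4 * r + 1) ^ d : ℕ) : ℝ) := by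
    have h1 : D.card ≤ (((Fintype.piFinset fun j : Fin d => Finset.Icc (a j) (a j + (4 * r : ℕ))) ×ˢ
        (Finset.univ : Finset (Fin d)))).card := Finset.card_filter_le _ _
    have h2 : (((Fintype.piFinset fun j : Fin d => Finset.Icc (a j) (a j + (4 * r : ℕ))) ×ˢ
        (Finset.univ : Finset (Fin d)))).card = (4 * r + 1) ^ d * d := by
      rw [Finset.card_product, Fintype.card_piFinset, Finset.card_univ, Fintype.card_fin]
      have hI : ∀ j : Fin d, (Finset.Icc (a j) (a j + ((4 * r : ℕ) : ℤ))).card = 4 * r + 1 := by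
        intro j
        rw [Int.card_Icc]
        have : a j + ((4 * r : ℕ) : ℤ) + 1 - a j = ((4 * r + 1 : ℕ) : ℤ) := by push_cast; ring
        rw [this, Int.toNat_natCast]
      rw [Finset.prod_congr rfl (fun j _ => hI j), Finset.prod_const, Finset.card_univ, Fintype.card_fin]
    have h3 : D.card ≤ d * (4 * r + 1) ^ d := by rw [mul_comm]; omega
    exact_mod_cast h3
  have hce : Real.exp (2 * (|β| * (2 * C * (plaquettesTouching ({e} : Finset (ZdEdge d))).card))) ≤
      Real.exp (2 * cbar) := Real.exp_le_exp.2 (by linarith [hcu e])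
  set Bd : ℝ := Real.exp (2 * cbar) * (K₁ * Real.exp (-(K₂ * (2 * r)))) with hBd
  have hB0 : 0 ≤ Bd := mul_nonneg (Real.exp_pos _).le (mul_nonneg hK₁ (Real.exp_pos _).le)
  have hS0 : 0 ≤ Ssum := Finset.sum_nonneg fun u _ =>
    mul_nonneg (Real.exp_pos _).le (mul_nonneg hK₁ (Real.exp_pos _).le)
  have hS1 : Ssum ≤ ((d * (4 * r + 1) ^ d : ℕ) : ℝ) * Bd := hsum.trans (mul_le_mul_of_nonneg_right hcard hB0)
  have hexp0 : 0 ≤ Real.exp (2 * cbar) := (Real.exp_pos _).le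
  have h2S : 0 ≤ 2 * Ssum := by linarith
  calc Real.exp (2 * (|β| * (2 * C * (plaquettesTouching ({e} : Finset (ZdEdge d))).card))) * (2 * Ssum)
      ≤ Real.exp (2 * cbar) * (2 * Ssum) := mul_le_mul_of_nonneg_right hce h2S
    _ ≤ Real.exp (2 * cbar) * (2 * (((d * (4 * r + 1) ^ d : ℕ) : ℝ) * Bd)) :=
        mul_le_mul_of_nonneg_left (by linarith) hexp0

/-- ★ **Chatterjee 2021, Lemma 7.5 on a cube, instantiated** (the expectation form of **Corollary 7.6**): under the
hypotheses of `abs_integral_update_sub_le_of_strongExpDecayZd_cube`, two boundary conditions agreeing off a finite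
set `A` of boundary edges of the cube give, for every measurable `f` with `|f| ≤ 1` reading only links at
base-point sup-distance `> 4r` from every edge of `A`, expectations differing by at most
`|A| · e^{2c̄} · 2 · d(4r+1)^d · e^{2c̄} K₁ e^{−2K₂ r}` (printed: `C₁ |A| r^{d−1} e^{−C₂ r}`).
[cite: Chatterjee2021, Lemma 7.5] -/
theorem abs_integral_sub_le_of_strongExpDecayZd_cube_of_eqOn [NeZero d] (hρ : Continuous ρ) {C : ℝ}
    (hC0 : 0 ≤ C) (hC : ∀ (x : Site d) (i j : Fin d) (U : LGConfig d G), |plaquetteObs ρ x i j U| ≤ C)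
    {β K₁ K₂ : ℝ} (hdecay : StrongExpDecayZd d ρ β K₁ K₂) (hK₂ : 0 ≤ K₂) (M : ℕ) (v : Fin d → ℤ)
    (Λ : Finset (ZdEdge d))
    (hΛ : Λ = (((Fintype.piFinset fun j : Fin d => Finset.Icc (v j) (v j + M)) ×ˢ
        (Finset.univ : Finset (Fin d))).filter fun e =>
          e.1 e.2 + 1 ≤ v e.2 + M ∧ ∀ j, j ≠ e.2 → v j < e.1 j ∧ e.1 j < v j + M))
    (A : Finset (ZdEdge d)) (hA : ∀ e ∈ A, (∀ j, v j ≤ e.1 j ∧ e.1 j ≤ v j + M) ∧ e.1 e.2 + 1 ≤ v e.2 + M ∧ e ∉ Λ)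
    (r : ℕ) (hr : 1 ≤ r) (hrM : 4 * r ≤ M) (η η' : LGConfig d G) (hηη' : ∀ e, e ∉ A → η e = η' e)
    {f : LGConfig d G → ℝ} (hfm : Measurable f) (hf1 : ∀ U, |f U| ≤ 1)
    (hfdep : DependsOn f {u : ZdEdge d | ∀ e ∈ A, (4 * r : ℝ) < ‖u.1 - e.1‖}) :
    |(∫ U, f U ∂(ymSpecification ρ β Λ η')) - ∫ U, f U ∂(ymSpecification ρ β Λ η)| ≤
      A.card * (Real.exp (2 * (|β| * (2 * C * (2 * (d - 1 : ℕ) : ℕ)))) *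
        (2 * ((d * (4 * r + 1) ^ d : ℕ) *
          (Real.exp (2 * (|β| * (2 * C * (2 * (d - 1 : ℕ) : ℕ)))) * (K₁ * Real.exp (-(K₂ * (2 * r)))))))) := by
  classical
  set Bd : ℝ := Real.exp (2 * (|β| * (2 * C * (2 * (d - 1 : ℕ) : ℕ)))) *
    (2 * ((d * (4 * r + 1) ^ d : ℕ) *
      (Real.exp (2 * (|β| * (2 * C * (2 * (d - 1 : ℕ) : ℕ)))) * (K₁ * Real.exp (-(K₂ * (2 * r))))))) with hBd
  have hfdep_e : ∀ e ∈ A, DependsOn f {u : ZdEdge d | (4 * r : ℝ) < ‖u.1 - e.1‖} := fun e he U V hUV =>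
    hfdep fun u hu => hUV u (hu e he)
  have key : ∀ s : Finset (ZdEdge d), s ⊆ A →
      |(∫ U, f U ∂(ymSpecification ρ β Λ (s.piecewise η' η))) - ∫ U, f U ∂(ymSpecification ρ β Λ η)| ≤
        s.card * Bd := by
    intro s
    induction s using Finset.induction_on with
    | empty =>
      intro _
      simp
    | insert e s hes ih =>
      intro hs
      have heA : e ∈ A := hs (Finset.mem_insert_self e s)
      have hsA : s ⊆ A := fun x hx => hs (Finset.mem_insert_of_mem hx)
      obtain ⟨he1, he2, heΛ⟩ := hA e heA
      rw [Finset.card_insert_of_notMem hes, Finset.piecewise_insert, Nat.cast_add, Nat.cast_one, add_mul, one_mul]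
      have hstep := abs_integral_update_sub_le_of_strongExpDecayZd_cube ρ hρ hC0 hC hdecay hK₂ M v Λ hΛ
        (s.piecewise η' η) e he1 he2 heΛ r hr hrM (η' e) hfm hf1 (hfdep_e e heA)
      have hprev := ih hsA
      calc |(∫ U, f U ∂(ymSpecification ρ β Λ (Function.update (s.piecewise η' η) e (η' e)))) -
              ∫ U, f U ∂(ymSpecification ρ β Λ η)|
          ≤ |(∫ U, f U ∂(ymSpecification ρ β Λ (Function.update (s.piecewise η' η) e (η' e)))) -
                ∫ U, f U ∂(ymSpecification ρ β Λ (s.piecewise η' η))| +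
              |(∫ U, f U ∂(ymSpecification ρ β Λ (s.piecewise η' η))) -
                ∫ U, f U ∂(ymSpecification ρ β Λ η)| := abs_sub_le _ _ _
        _ ≤ Bd + s.card * Bd := add_le_add hstep hprev
        _ = s.card * Bd + Bd := by ring
  have hpw : A.piecewise η' η = η' := by
    funext e
    by_cases he : e ∈ A
    · rw [Finset.piecewise_eq_of_mem _ _ _ he]
    · rw [Finset.piecewise_eq_of_notMem _ _ _ he, hηη' e he]
  have := key A le_rfl
  rwa [hpw] at this

end Cube

end Literature.MathematicalPhysics.QuantumLattice

end
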